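import Summits.Schanuel.Schanuel.Theorems.RootDecomp1KHyper37

/-!
# RootDecomp1KHyper — lens 6, generation 15 ADDENDA (ExpAnchorT v2 88910796… §1–§6 · PiAnchorT b5ead9a0… §7 · PiAnchorU ed654c66… §8–§9) — continuation (RootDecomp1KHyper38): §8 first half (lens-6 g15 ADDENDUM 3 «UNIFORM MEASURED-LATTICE-ANCHOR THEOREM», PiAnchorU.lean ed654c66…, ll. 2881–3094): `WeakLatLB`, `weakLatLB_of_mvWeakMeasure`, weak Lemma L `exists_cvec_ne_zeroW` / `exists_level_dot_ne_zeroW`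

(lens-6 g15 addenda: `ExpAnchorT.lean` v2 88910796… = parts 28–35, `PiAnchorT.lean` b5ead9a0… §7 = parts 36–37, `PiAnchorU.lean` ed654c66… §8–§9 (U ll. 2881–3654; A–I byte-identical to T up to the two lint fixes) = parts 38–41;
farm rc 0 · 0 sorry · axioms std; port by census-1 gen 14, CENSUS-REQUESTs STATUS L1561 / L1583 / L1616, critic PORT GO L1568 (e) / L1588 (e) / L1617 (e); import `RootDecomp1KHyper26` (+ the two Nesterenko Literature modules from part 36 on),
sub-namespace `…HyperCell.LatCell`; statements and proofs verbatim (docstrings added, generic one-liners privatised; lint fixes: L1588 (a)'s two in §7c and two unused simp args `Matrix.head_cons` in §8a); binders hLW / h52 / hNW BY NAME; `--supports stmt-Schanuel-33363` (residual of record n = 3 := UnanchoredResidual₃‴, critic L1617 (c)). Nothing here proves Schanuel; rung 0.)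
-/

noncomputable section

open Complex IntermediateField Polynomial

namespace Summit.Schanuel.Schanuel.Theorems.RootDecomp1KHyper

namespace HyperCell

namespace LatCell

variable {n : ℕ}
open Summit.Schanuel.Schanuel.Theorems.RootDecomp1KGeneric (HasHLPairInSpan Rank3SpanResidual
  mem_adjoin_of_mem_span cexp_mem_adjoin_of_mem_span)

/-- `exp(−x) ≤ 1/x` for `x > 0`. -/
private theorem exp_neg_le_one_div' {x : ℝ} (hx : 0 < x) : Real.exp (-x) ≤ 1 / x := by
  rw [Real.exp_neg, ← one_div]
  exact one_div_le_one_div_of_le hx (by linarith [Real.add_one_le_exp x])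

/-! ## §8  WEAK LATTICE BOUNDS: the UNIFORM measured-lattice-anchor theorem; the Nesterenko cell
mod Cor. 5.2 ONLY

Lemma L (`exists_level_dot_ne_zeroL`) is the one place where §3's extraction used a POLYNOMIAL lower
bound `LatLB w₁ w₂` for the lattice forms `U w₁ + V w₂`.  A sub-exponential bound
`‖U w₁ + V w₂‖ ≥ exp(−C (1+|U|+|V|)^k)` suffices: at level `m` the competing smallness is
`exp(−(1+|h|₁)^m)` and `m → ∞`.  Consequently the WHOLE cell engine runs on an `MvWeakMeasure` alone:
for ANY pair `θ` with a weak simultaneous measure inside `ℚ(z, e^z, i)` and ANY two polynomially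
independent lattice points `W₁(θ), W₂(θ) ∈ span_ℤ(z)`, `SB 3 z` (`sb_three_of_measuredLatAnchor`).
Corollaries: the §7 cell WITHOUT the `π`-measure binder (`sb_three_of_piIntAnchor'`, mod Cor. 5.2 only),
and the broader NESTERENKO-LATTICE cell `HasPiLatAnchor z` := "`π ∈ span_ℤ(z)` and a second point of
`ℤ[e^{π}, π]` in `span_ℤ(z)`, polynomially independent of `π`" (e.g. `N₁`, `N e^{π}`, `π²`, `π e^{π}`…),
decided mod Cor. 5.2 only (`sb_three_of_piLatAnchor`). -/

/-- Weak (sub-exponential) lower bound for the binary lattice forms `U w₁ + V w₂`. -/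
def WeakLatLB (w₁ w₂ : ℂ) : Prop :=
  ∃ (C : ℝ) (k : ℕ), 0 < C ∧ ∀ U V : ℤ, (U ≠ 0 ∨ V ≠ 0) →
    Real.exp (-(C * (1 + |(U : ℝ)| + |(V : ℝ)|) ^ k)) ≤ ‖(U : ℂ) * w₁ + (V : ℂ) * w₂‖

/-- A weak lattice lower bound forces every non-trivial integer combination `U w₁ + V w₂` to be non-zero. -/
theorem WeakLatLB.ne_zero {w₁ w₂ : ℂ} (h : WeakLatLB w₁ w₂) {U V : ℤ} (hUV : U ≠ 0 ∨ V ≠ 0) :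
    (U : ℂ) * w₁ + (V : ℂ) * w₂ ≠ 0 := by
  obtain ⟨C, k, _, h⟩ := h
  have h1 := h U V hUV
  intro h0
  rw [h0, norm_zero] at h1
  exact absurd h1 (not_le.mpr (Real.exp_pos _))

/-- A polynomial lattice bound is a weak one. -/
theorem LatLB.weakLatLB {w₁ w₂ : ℂ} (h : LatLB w₁ w₂) : WeakLatLB w₁ w₂ := by
  obtain ⟨C, τ, hC, h⟩ := h
  refine ⟨C, τ, hC, fun U V hUV => ?_⟩
  have h1 := h U V hUV
  have hX : 0 < C * (1 + |(U : ℝ)| + |(V : ℝ)|) ^ τ := by positivity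
  calc Real.exp (-(C * (1 + |(U : ℝ)| + |(V : ℝ)|) ^ τ))
      ≤ 1 / (C * (1 + |(U : ℝ)| + |(V : ℝ)|) ^ τ) := exp_neg_le_one_div' hX
    _ ≤ ‖(U : ℂ) * w₁ + (V : ℂ) * w₂‖ := by
        rw [div_le_iff₀ hX]; linarith [h1]

/-- Weak lattice bound for two polynomially independent points of `ℤ[θ]`, `θ` weakly measured. -/
theorem weakLatLB_of_mvWeakMeasure {n : ℕ} {θ : Fin n → ℂ} (hθ : MvWeakMeasure θ)
    (W₁ W₂ : MvPolynomial (Fin n) ℤ)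
    (hW : ∀ U V : ℤ, (U ≠ 0 ∨ V ≠ 0) → MvPolynomial.C U * W₁ + MvPolynomial.C V * W₂ ≠ 0) :
    WeakLatLB (MvPolynomial.aeval θ W₁) (MvPolynomial.aeval θ W₂) := by
  obtain ⟨C, k, hC, h⟩ := hθ (max W₁.totalDegree W₂.totalDegree)
  set Λ : ℝ := 1 + ((mvlen W₁ : ℤ) : ℝ) + ((mvlen W₂ : ℤ) : ℝ) with hΛ
  have hL₁ : (0 : ℝ) ≤ ((mvlen W₁ : ℤ) : ℝ) := by exact_mod_cast mvlen_nonneg _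
  have hL₂ : (0 : ℝ) ≤ ((mvlen W₂ : ℤ) : ℝ) := by exact_mod_cast mvlen_nonneg _
  have hΛ1 : 1 ≤ Λ := by rw [hΛ]; linarith only [hL₁, hL₂]
  refine ⟨C * Λ ^ k, k, by positivity, fun U V hUV => ?_⟩
  set P : MvPolynomial (Fin n) ℤ := mvcombo ![U, V] ![W₁, W₂] with hPdef
  have hPeq : P = MvPolynomial.C U * W₁ + MvPolynomial.C V * W₂ := by
    rw [hPdef]; unfold mvcombo; rw [Fin.sum_univ_two]; rfl
  have hP0 : P ≠ 0 := by rw [hPeq]; exact hW U V hUV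
  have hdeg : P.totalDegree ≤ max W₁.totalDegree W₂.totalDegree := by
    rw [hPdef]
    refine totalDegree_mvcombo_le _ _ fun i => ?_
    match i with
    | 0 => exact le_max_left _ _
    | 1 => exact le_max_right _ _
  have hval : MvPolynomial.aeval θ P =
      (U : ℂ) * MvPolynomial.aeval θ W₁ + (V : ℂ) * MvPolynomial.aeval θ W₂ := by
    rw [hPdef, aeval_mvcombo, Fin.sum_univ_two]; rfl
  have hlen : ((mvlen P : ℤ) : ℝ) ≤ (1 + |(U : ℝ)| + |(V : ℝ)|) * Λ := by
    have h1 : ((mvlen P : ℤ) : ℝ) ≤ ((∑ i, |(![U, V] : Fin 2 → ℤ) i| * mvlen ((![W₁, W₂] :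
        Fin 2 → MvPolynomial (Fin n) ℤ) i) : ℤ) : ℝ) := by
      rw [hPdef]; exact_mod_cast mvlen_mvcombo_le _ _
    refine h1.trans ?_
    rw [Fin.sum_univ_two]
    simp only [Matrix.cons_val_zero, Matrix.cons_val_one]
    push_cast
    have hU0 := abs_nonneg (U : ℝ)
    have hV0 := abs_nonneg (V : ℝ)
    nlinarith [mul_nonneg hU0 hL₂, mul_nonneg hV0 hL₁, hL₁, hL₂, mul_nonneg hU0 hL₁,
      mul_nonneg hV0 hL₂]
  have h1 := h P hP0 hdeg
  have hlen0 : (0 : ℝ) ≤ ((mvlen P : ℤ) : ℝ) := by exact_mod_cast mvlen_nonneg _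
  have h2 : ((mvlen P : ℤ) : ℝ) ^ k ≤ ((1 + |(U : ℝ)| + |(V : ℝ)|) * Λ) ^ k :=
    pow_le_pow_left₀ hlen0 hlen k
  rw [hval] at h1
  calc Real.exp (-(C * Λ ^ k * (1 + |(U : ℝ)| + |(V : ℝ)|) ^ k))
      ≤ Real.exp (-(C * ((mvlen P : ℤ) : ℝ) ^ k)) := by
        apply Real.exp_le_exp.mpr
        apply neg_le_neg
        calc C * ((mvlen P : ℤ) : ℝ) ^ k ≤ C * ((1 + |(U : ℝ)| + |(V : ℝ)|) * Λ) ^ k :=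
              mul_le_mul_of_nonneg_left h2 hC.le
          _ = C * Λ ^ k * (1 + |(U : ℝ)| + |(V : ℝ)|) ^ k := by rw [mul_pow]; ring
    _ ≤ ‖(U : ℂ) * MvPolynomial.aeval θ W₁ + (V : ℂ) * MvPolynomial.aeval θ W₂‖ := h1

/-- `exists_cvec_ne_zeroL` under the weak bound (only non-vanishing is used). -/
theorem exists_cvec_ne_zeroW {z : Fin 3 → ℂ} {w₁ w₂ : ℂ} (hLB : WeakLatLB w₁ w₂)
    {a b : Fin 3 → ℤ} (ha : ∑ i, (a i : ℂ) * z i = w₁) (hb : ∑ i, (b i : ℂ) * z i = w₂) :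
    ∃ j, cvec a b j ≠ 0 := by
  by_contra hall
  push Not at hall
  have h0 : (a 1 : ℂ) * b 2 - a 2 * b 1 = 0 := by exact_mod_cast hall 0
  have h1 : (a 2 : ℂ) * b 0 - a 0 * b 2 = 0 := by exact_mod_cast hall 1
  have h2 : (a 0 : ℂ) * b 1 - a 1 * b 0 = 0 := by exact_mod_cast hall 2
  have hw₁ : w₁ ≠ 0 := by
    have := hLB.ne_zero (U := 1) (V := 0) (Or.inl one_ne_zero)
    simpa using this
  have ha0 : a ≠ 0 := by
    intro h
    apply hw₁
    rw [← ha]; simp [h]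
  obtain ⟨k, hk⟩ := Function.ne_iff.mp ha0
  have ha3 := ha
  have hb3 := hb
  rw [Fin.sum_univ_three] at ha3 hb3
  have hpar : ∀ k : Fin 3, (a k : ℂ) * w₂ = (b k : ℂ) * w₁ := by
    intro k
    rw [← ha3, ← hb3]
    match k with
    | 0 => linear_combination (z 1) * h2 - (z 2) * h1
    | 1 => linear_combination (-(z 0)) * h2 + (z 2) * h0
    | 2 => linear_combination (z 0) * h1 - (z 1) * h0
  have hrel : ((b k : ℤ) : ℂ) * w₁ + ((-a k : ℤ) : ℂ) * w₂ = 0 := by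
    push_cast; linear_combination (-1 : ℂ) * hpar k
  exact hLB.ne_zero (Or.inr (neg_ne_zero.mpr hk)) hrel

/-- **LEMMA L under a WEAK lattice bound.**  For every sufficiently high level `m`, a non-zero form
`h·z` of size `< exp(−(1+|h|₁)^m)` has `c·h ≠ 0`: otherwise `c_j (h·z) = A w₁ + B w₂` with
`1 + |A| + |B| ≤ κ (1+|h|₁)`, and `exp(−C₀ κ^k (1+|h|₁)^k) ≤ c_j exp(−(1+|h|₁)^m)` fails for
`m ≥ k + T`, `2^T ≥ C₀ κ^k + c_j`. -/
theorem exists_level_dot_ne_zeroW {z : Fin 3 → ℂ} (hz : LinearIndependent ℚ z) {w₁ w₂ : ℂ}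
    (hLB : WeakLatLB w₁ w₂) {a b : Fin 3 → ℤ} (ha : ∑ i, (a i : ℂ) * z i = w₁)
    (hb : ∑ i, (b i : ℂ) * z i = w₂) {j : Fin 3} (hj : cvec a b j ≠ 0) :
    ∃ mL : ℕ, ∀ m : ℕ, mL ≤ m → ∀ h : Fin 3 → ℤ, h ≠ 0 →
      ‖∑ i, (h i : ℂ) * z i‖ < Real.exp (-((1 + ∑ i, |(h i : ℝ)|) ^ m)) →
        (∑ i, cvec a b i * h i) ≠ 0 := by
  obtain ⟨C₀, k, hC₀, hLBall⟩ := hLB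
  set Sa : ℝ := ∑ i, |(a i : ℝ)| with hSa
  set Sb : ℝ := ∑ i, |(b i : ℝ)| with hSb
  have hSa0 : 0 ≤ Sa := Finset.sum_nonneg fun _ _ => abs_nonneg _
  have hSb0 : 0 ≤ Sb := Finset.sum_nonneg fun _ _ => abs_nonneg _
  set cj : ℝ := |(cvec a b j : ℝ)| with hcj
  have hcj1 : 1 ≤ cj := by rw [hcj, ← Int.cast_abs]; exact_mod_cast Int.one_le_abs hj
  have hcj0 : 0 < cj := by linarith only [hcj1]
  set κ : ℝ := 1 + Sb + Sa with hκ
  have hκ1 : 1 ≤ κ := by rw [hκ]; linarith only [hSa0, hSb0]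
  have hκ0 : 0 < κ := by linarith only [hκ1]
  set κ₁ : ℝ := C₀ * κ ^ k + cj with hκ₁
  have hκ₁0 : 0 < κ₁ := by positivity
  obtain ⟨T, hT⟩ := exists_le_two_pow κ₁
  refine ⟨T + k, fun m hm h hh hsmall hC => ?_⟩
  obtain ⟨m', rfl⟩ : ∃ m', m = m' + k := ⟨m - k, by omega⟩
  set Sh : ℝ := ∑ i, |(h i : ℝ)| with hSh
  set W : ℝ := 1 + Sh with hW
  have hSh1 : 1 ≤ Sh := one_le_hsum hh
  have hW2 : 2 ≤ W := by rw [hW]; linarith only [hSh1]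
  have hW1 : 1 ≤ W := by linarith only [hW2]
  have hW0 : 0 < W := by linarith only [hW2]
  have hShW : Sh ≤ W := by rw [hW]; linarith only [hSh1]
  set F : ℂ := ∑ i, (h i : ℂ) * z i with hF
  have hF0 : F ≠ 0 := form_ne_zero_of_linearIndependent hz hh
  have hkey := cvec_key a b h z j
  rw [← hF, ha, hb, hC] at hkey
  simp only [Int.cast_zero, zero_mul, add_zero] at hkey
  set A : ℤ := cvec h b j with hA
  set B : ℤ := cvec a h j with hB
  have hAB : A ≠ 0 ∨ B ≠ 0 := by
    by_contra hn
    push Not at hn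
    obtain ⟨hA0, hB0⟩ := hn
    have : (cvec a b j : ℂ) * F = 0 := by rw [hkey, hA0, hB0]; simp
    rcases mul_eq_zero.mp this with h1 | h1
    · exact hj (by exact_mod_cast h1)
    · exact hF0 h1
  have hnorm : ‖(A : ℂ) * w₁ + (B : ℂ) * w₂‖ = cj * ‖F‖ := by
    rw [← hkey, norm_mul, Complex.norm_intCast]
  have hlow := hLBall A B hAB
  rw [hnorm] at hlow
  have hAle : |(A : ℝ)| ≤ Sh * Sb := abs_cvec_le h b j
  have hBle : |(B : ℝ)| ≤ Sa * Sh := abs_cvec_le a h j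
  have hheight : 1 + |(A : ℝ)| + |(B : ℝ)| ≤ κ * W := by
    have h1 : |(A : ℝ)| ≤ W * Sb := hAle.trans (mul_le_mul_of_nonneg_right hShW hSb0)
    have h2 : |(B : ℝ)| ≤ Sa * W := hBle.trans (mul_le_mul_of_nonneg_left hShW hSa0)
    rw [hκ]; nlinarith only [h1, h2, hW1, hSa0, hSb0]
  have hh0 : 0 ≤ 1 + |(A : ℝ)| + |(B : ℝ)| := by positivity
  have hpowle : (1 + |(A : ℝ)| + |(B : ℝ)|) ^ k ≤ κ ^ k * W ^ k := by
    rw [← mul_pow]; exact pow_le_pow_left₀ hh0 hheight k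
  have hWk1 : 1 ≤ W ^ k := one_le_pow₀ hW1
  have hlogcj : Real.log cj ≤ cj := by
    have := Real.log_le_sub_one_of_pos hcj0
    linarith only [this]
  have h3 : κ₁ ≤ W ^ m' :=
    calc κ₁ ≤ 2 ^ T := hT
      _ ≤ W ^ T := pow_le_pow_left₀ (by norm_num) hW2 T
      _ ≤ W ^ m' := pow_le_pow_right₀ hW1 (by omega)
  have hbig : C₀ * κ ^ k * W ^ k + Real.log cj ≤ W ^ (m' + k) := by
    have hWk0 : 0 ≤ W ^ k := by positivity
    have hcjW : cj ≤ cj * W ^ k := le_mul_of_one_le_right hcj0.le hWk1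
    calc C₀ * κ ^ k * W ^ k + Real.log cj ≤ C₀ * κ ^ k * W ^ k + cj * W ^ k := by
          linarith only [hlogcj, hcjW]
      _ = κ₁ * W ^ k := by rw [hκ₁]; ring
      _ ≤ W ^ m' * W ^ k := mul_le_mul_of_nonneg_right h3 hWk0
      _ = W ^ (m' + k) := by rw [pow_add]
  have hchain : cj * ‖F‖ < cj * ‖F‖ :=
    calc cj * ‖F‖ < cj * Real.exp (-(W ^ (m' + k))) := mul_lt_mul_of_pos_left hsmall hcj0
      _ ≤ cj * Real.exp (-(C₀ * κ ^ k * W ^ k + Real.log cj)) :=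
          mul_le_mul_of_nonneg_left (Real.exp_le_exp.mpr (neg_le_neg hbig)) hcj0.le
      _ = Real.exp (-(C₀ * κ ^ k * W ^ k)) := by
          rw [neg_add, Real.exp_add, Real.exp_neg (Real.log cj), Real.exp_log hcj0]
          field_simp
      _ ≤ Real.exp (-(C₀ * (1 + |(A : ℝ)| + |(B : ℝ)|) ^ k)) := by
          apply Real.exp_le_exp.mpr
          apply neg_le_neg
          calc C₀ * (1 + |(A : ℝ)| + |(B : ℝ)|) ^ k ≤ C₀ * (κ ^ k * W ^ k) :=
                mul_le_mul_of_nonneg_left hpowle hC₀.le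
            _ = C₀ * κ ^ k * W ^ k := by ring
      _ ≤ cj * ‖F‖ := hlow
  exact absurd hchain (lt_irrefl _)

end LatCell

end HyperCell

end Summit.Schanuel.Schanuel.Theorems.RootDecomp1KHyper
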